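import Literature.Geometry.Kaehler.ComplexTorusAbelianFivefoldEllipticFactorConditionD
import Mathlib.FieldTheory.IntermediateField.Adjoin.Basic
import HarnessLib

/-!
# Moonen–Zarhin 1999 Thm. (0.2) (2), case (f), the Hodge group: `Hg(X₀ × X₁ × X₂) = Hg(X₀) × Hg(X₁ × X₂)` for an
# elliptic curve `X₀`, an elliptic curve `X₁` with complex multiplication by `k`, and a simple abelian threefold `X₂` with
# `k ↪ End⁰(X₂)`, `X₀ ≁ X₁`

Layer `Literature/Geometry/Kaehler`, namespace `Literature.Geometry.Kaehler.ComplexTorus`; lane `lit-hodgefound` (Track 2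
foundations library); prover seat `lit-hodgefound-p17`, generation 57, self-proposed row g57-#7 — sequel of ✔ g55-#2
`ComplexTorusAbelianFivefoldEllipticFactorConditionD` (the same product `(T × E_σ) × E_τ` OUTSIDE the cases (e) ∕ (f)); here
case (f) itself.  THEOREMS ONLY (no definition, no instance, no notation, no named fact; D-0026 net debt `0`).

## Source, VERBATIM (held `paper:arxiv-math_9901113`; locators are page ∕ line of the materialisation)

B. J. J. Moonen, Yu. G. Zarhin [MoonenZarhin1999LowDim], *Hodge classes on abelian varieties of low dimension*, Math. Ann.
**315** (1999) 711–733.  The cases (p0001 L129–L135): «(a) The abelian variety `X` is isogenous to a product `X₁ × X₂` where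
`X₁` is an elliptic curve with complex multiplication by an imaginary quadratic field `k` and where `X₂` is a simple abelian
threefold such that there exists an embedding `k ↪ End⁰(X₂)`. … (f) The abelian variety `X` is isogenous to a product
`X₀ × X₁ × X₂`, where `X₀` is an elliptic curve, where `X₁` and `X₂` are as in (a), and such that `X₀` and `X₁` are not
isogenous.»  Thm. (0.2) (2) (p0001 L157–L158): «Suppose we are in case (f). Then `Hg(X) = Hg(X₀) × Hg(X₁ × X₂)`.»  Proof,
§5 (5.11) (p0010 L57–L63): «If `d_max = 3` then `Y` is isogenous to a product of an elliptic curve `Y₁` and a simple abelian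
threefold `Y₂`. If `End⁰(Y₂)` contains an imaginary quadratic field then this subfield is unique. Therefore, possibly after
interchanging the roles of `E` and `Y₁` we find that there does not exist an embedding of `End⁰(E)` into the center of
`End⁰(Y)`. (Note that `End⁰(E) = End⁰(Y₁)` implies that `E ∼ Y₁`, which we excluded.) Again by Proposition (3.8) we then
find `Hg(X) = Hg(E) × Hg(Y)`.» and (5.12) (p0011 L14–L16): «Case (f) is easy. It was established in (5.11) … that
`Hg(X) = Hg(X₀) × Hg(X₁ × X₂)`.»; Prop. (3.8) (p0007 L55–L74).

* H. Lange [Lange2023AbelianVarietiesComplex], *Abelian Varieties over the Complex Numbers* (2023), §1.1.2 Cor. 1.1.16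
  (`[Z(End⁰ X) : ℚ] ∣ 2 dim X`), §2.4.4 Cor. 2.4.26.

## The argument

`X = (T × E_σ) × E_τ` with `T` a SIMPLE polarised threefold, `E_σ` WITH complex multiplication (so `σ` is imaginary
quadratic) whose CM field `ℚ(σ)` embeds into the centre `F = Z(End⁰ T)` (a complex embedding of `F` takes the value `σ`),
and `E_τ ≁ E_σ`.  If `E_τ` has no complex multiplication, Prop. (3.8) with `End(E_τ) = ℤ` and `Hom(E_τ, T × E_σ) = 0`
(the tree's `IsAbelianVariety.hodgeGroupC_prod_ellipticPeriod_eq_blockDiagProd_of_homRat_eq_bot`).  If `E_τ` has complex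
multiplication by `ℚ(τ)` and the Hodge group does not split, the CM half of (3.8) for `(T × E_σ) × E_τ` (the tree's
`IsAbelianVariety.exists_algHom_center_endAlgRat_or_isIsogenous_of_hodgeGroupC_prod_ellipticPeriod_prod_ellipticPeriod_ne`)
embeds `ℚ(τ)` into `F` as well (or makes `E_σ ∼ E_τ`).  «THIS SUBFIELD IS UNIQUE»: `[F : ℚ] ∣ 6`, and two imaginary
quadratic elements `c₁, c₂ ∈ F` generate a subfield of degree `2` or `4`, so of degree `2`: `c₂ ∈ ℚ(c₁)` — the purely
field-theoretic `mem_span_one_tau_of_ringHom_apply_eq` (§1).  Hence `τ ∈ ℚ + ℚσ` and `E_σ ∼ E_τ` (the tree's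
`isIsogenous_ellipticPeriod_of_mem_span_one_tau`), contradiction.

## What is proved

* §1 **`mem_span_one_tau_of_ringHom_apply_eq`** — a number field `F` with `4 ∤ [F : ℚ]` receiving two imaginary quadratic
  numbers `σ = φ(c₁)`, `τ = χ(c₂)` under complex embeddings `φ, χ` has `τ ∈ ℚ + ℚσ`.
* §2 **`IsSimple.hodgeGroupC_prod_ellipticPeriod_prod_ellipticPeriod_eq_blockDiagProd_of_finrank_eq_three_of_apply_eq`** — Thm. (0.2)
  (2), the Hodge group, on complex points; the real-points form `…hodgeGroup_prod_ellipticPeriod_prod_ellipticPeriod_eq_…`;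
  the `IsAbelianVariety` form.
-/

noncomputable section

open Module Matrix Complex Function Polynomial

namespace Literature.Geometry.Kaehler

namespace ComplexTorus

/-! ## §1 «If `End⁰(Y₂)` contains an imaginary quadratic field then this subfield is unique» -/

section Subfield

open IntermediateField

/-- **Two imaginary quadratic numbers received by a number field of degree not divisible by `4` span the same
`ℚ`-line modulo `ℚ`**: if `φ, χ : F → ℂ` are ring homomorphisms of a number field `F` with `4 ∤ [F : ℚ]`, `σ = φ(c₁)` and
`τ = χ(c₂)` are non-real and quadratic over `ℚ`, then `τ ∈ ℚ + ℚσ` (the subfields `ℚ(c₁)`, `ℚ(c₂) ⊆ F` have degree `2`,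
their compositum degree `2` or `4`, hence `2`, so `c₂ = a + b c₁`, and `χ(c₁) ∈ {σ, σ̄}`).
[cite: MoonenZarhin1999LowDim, §5 (5.11) (p0010 L58–L59: «this subfield is unique»)] -/
theorem mem_span_one_tau_of_ringHom_apply_eq {F : Type*} [Field F] [NumberField F] (hd : ¬ 4 ∣ finrank ℚ F)
    {σ τ : ℂ} (hσ : σ.im ≠ 0) (hσq : ∃ p q : ℚ, σ ^ 2 + p * σ + q = 0) (hτq : ∃ p q : ℚ, τ ^ 2 + p * τ + q = 0)
    (φ χ : F →+* ℂ) {c₁ c₂ : F} (h₁ : φ c₁ = σ) (h₂ : χ c₂ = τ) :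
    τ ∈ Submodule.span ℚ (Set.range ![(1 : ℂ), σ]) := by
  classical
  obtain ⟨p, q, hpq⟩ := hσq
  obtain ⟨p', q', hpq'⟩ := hτq
  have hφQ : ∀ r : ℚ, φ (algebraMap ℚ F r) = r := fun r => by rw [eq_ratCast (algebraMap ℚ F) r, map_ratCast]
  have hχQ : ∀ r : ℚ, χ (algebraMap ℚ F r) = r := fun r => by rw [eq_ratCast (algebraMap ℚ F) r, map_ratCast]
  -- the quadratic relations pulled back to `F`
  have hc₁ : c₁ ^ 2 + algebraMap ℚ F p * c₁ + algebraMap ℚ F q = 0 := φ.injective (by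
    rw [map_add, map_add, map_mul, map_pow, hφQ, hφQ, h₁, map_zero, hpq])
  have hc₂ : c₂ ^ 2 + algebraMap ℚ F p' * c₂ + algebraMap ℚ F q' = 0 := χ.injective (by
    rw [map_add, map_add, map_mul, map_pow, hχQ, hχQ, h₂, map_zero, hpq'])
  -- the monic quadratic `P = X² + pX + q` and the degree of `c₁`
  obtain ⟨P, hP⟩ : ∃ P : ℚ[X], P = X ^ 2 + C p * X + C q := ⟨_, rfl⟩
  have hPm : P.Monic := by
    rw [hP, add_assoc]
    exact (monic_X_pow 2).add_of_left (lt_of_le_of_lt (degree_add_le _ _) (max_lt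
      (lt_of_le_of_lt (degree_C_mul_X_le p) (by rw [degree_X_pow]; exact_mod_cast one_lt_two))
      (lt_of_le_of_lt degree_C_le (by rw [degree_X_pow]; exact_mod_cast two_pos))))
  have hPdeg : P.natDegree = 2 := by
    rw [hP, add_assoc, natDegree_add_eq_left_of_natDegree_lt] <;> rw [natDegree_X_pow]
    exact lt_of_le_of_lt (natDegree_add_le _ _) (max_lt
      (lt_of_le_of_lt ((natDegree_C_mul_le p X).trans natDegree_X_le) one_lt_two) (by rw [natDegree_C]; exact two_pos))
  have hP0 : P ≠ 0 := hPm.ne_zero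
  have hPc₁ : aeval c₁ P = 0 := by rw [hP, map_add, map_add, map_mul, map_pow, aeval_X, aeval_C, aeval_C, hc₁]
  have hint₁ : IsIntegral ℚ c₁ := ⟨P, hPm, by rwa [← aeval_def]⟩
  have hdeg₁ : (minpoly ℚ c₁).natDegree = 2 := by
    have hle : (minpoly ℚ c₁).natDegree ≤ 2 := hPdeg ▸ natDegree_le_of_dvd (minpoly.dvd ℚ c₁ hPc₁) hP0
    have hpos : 0 < (minpoly ℚ c₁).natDegree := minpoly.natDegree_pos hint₁
    have hne1 : (minpoly ℚ c₁).natDegree ≠ 1 := fun h1 => by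
      have hmem : c₁ ∈ (algebraMap ℚ F).range :=
        minpoly.degree_eq_one_iff.1 ((degree_eq_iff_natDegree_eq (minpoly.ne_zero hint₁)).2 h1)
      obtain ⟨r, hr⟩ := RingHom.mem_range.1 hmem
      apply hσ
      rw [← h₁, ← hr, hφQ, Complex.ratCast_im]
    omega
  -- `K₁ = ℚ(c₁)` of degree `2`, and `L = K₁(c₂)` of degree `1` or `2` over `K₁`
  have hK₁ : finrank ℚ ℚ⟮c₁⟯ = 2 := by rw [adjoin.finrank hint₁, hdeg₁]
  haveI : FiniteDimensional ℚ ℚ⟮c₁⟯ := FiniteDimensional.of_finrank_pos (by rw [hK₁]; exact two_pos)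
  have hint₂ : IsIntegral ℚ⟮c₁⟯ c₂ := IsIntegral.of_finite ℚ⟮c₁⟯ c₂
  have hP'c₂ : aeval c₂ (X ^ 2 + C (algebraMap ℚ ℚ⟮c₁⟯ p') * X + C (algebraMap ℚ ℚ⟮c₁⟯ q')) = 0 := by
    rw [map_add, map_add, map_mul, map_pow, aeval_X, aeval_C, aeval_C, ← IsScalarTower.algebraMap_apply,
      ← IsScalarTower.algebraMap_apply, hc₂]
  have hP'm : (X ^ 2 + C (algebraMap ℚ ℚ⟮c₁⟯ p') * X + C (algebraMap ℚ ℚ⟮c₁⟯ q') : ℚ⟮c₁⟯[X]).Monic := by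
    rw [add_assoc]
    exact (monic_X_pow 2).add_of_left (lt_of_le_of_lt (degree_add_le _ _) (max_lt
      (lt_of_le_of_lt (degree_C_mul_X_le _) (by rw [degree_X_pow]; exact_mod_cast one_lt_two))
      (lt_of_le_of_lt degree_C_le (by rw [degree_X_pow]; exact_mod_cast two_pos))))
  have hP'deg : (X ^ 2 + C (algebraMap ℚ ℚ⟮c₁⟯ p') * X + C (algebraMap ℚ ℚ⟮c₁⟯ q') : ℚ⟮c₁⟯[X]).natDegree = 2 := by
    rw [add_assoc, natDegree_add_eq_left_of_natDegree_lt] <;> rw [natDegree_X_pow]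
    exact lt_of_le_of_lt (natDegree_add_le _ _) (max_lt
      (lt_of_le_of_lt ((natDegree_C_mul_le _ X).trans natDegree_X_le) one_lt_two) (by rw [natDegree_C]; exact two_pos))
  have hm_le : finrank ℚ⟮c₁⟯ ℚ⟮c₁⟯⟮c₂⟯ ≤ 2 := by
    rw [adjoin.finrank hint₂]
    exact hP'deg ▸ natDegree_le_of_dvd (minpoly.dvd _ c₂ hP'c₂) hP'm.ne_zero
  have hm_pos : 0 < finrank ℚ⟮c₁⟯ ℚ⟮c₁⟯⟮c₂⟯ := by
    rw [adjoin.finrank hint₂]; exact minpoly.natDegree_pos hint₂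
  -- towers: `[L : ℚ] = 2 m` divides `[F : ℚ]`
  have htow₁ := Module.finrank_mul_finrank ℚ ℚ⟮c₁⟯ ℚ⟮c₁⟯⟮c₂⟯
  have htow₂ := Module.finrank_mul_finrank ℚ ℚ⟮c₁⟯⟮c₂⟯ F
  rw [hK₁] at htow₁
  have hm1 : finrank ℚ⟮c₁⟯ ℚ⟮c₁⟯⟮c₂⟯ = 1 := by
    rcases Nat.lt_or_ge (finrank ℚ⟮c₁⟯ ℚ⟮c₁⟯⟮c₂⟯) 2 with h | h
    · omega
    · exfalso
      have h2 : finrank ℚ⟮c₁⟯ ℚ⟮c₁⟯⟮c₂⟯ = 2 := le_antisymm hm_le h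
      apply hd
      rw [← htow₂, ← htow₁, h2]
      exact Dvd.intro _ rfl
  -- so `c₂ ∈ K₁ = ℚ(c₁)`: `c₂ = b c₁ + a`
  have hc₂K : c₂ ∈ ℚ⟮c₁⟯ := by
    have hbot : ℚ⟮c₁⟯⟮c₂⟯ = ⊥ := finrank_eq_one_iff.1 hm1
    obtain ⟨k, hk⟩ := mem_bot.1 (adjoin_simple_eq_bot_iff.1 hbot)
    rw [← hk]
    exact k.2
  obtain ⟨a, b, hab⟩ : ∃ a b : ℚ, c₂ = algebraMap ℚ F b * c₁ + algebraMap ℚ F a := by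
    have hmem : c₂ ∈ (ℚ⟮c₁⟯).toSubalgebra := hc₂K
    rw [adjoin_simple_toSubalgebra_of_isAlgebraic hint₁.isAlgebraic, Algebra.adjoin_singleton_eq_range_aeval] at hmem
    obtain ⟨f, hf⟩ := (AlgHom.mem_range _).1 hmem
    refine ⟨(f %ₘ P).coeff 0, (f %ₘ P).coeff 1, ?_⟩
    have hr : aeval c₁ (f %ₘ P) = c₂ := by rw [aeval_modByMonic_eq_self_of_root hPc₁, hf]
    have hrdeg : (f %ₘ P).degree ≤ 1 := by
      have h := degree_modByMonic_lt f hPm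
      rw [degree_eq_natDegree hP0, hPdeg] at h
      exact Order.le_of_lt_succ (by exact_mod_cast h)
    rw [← hr]
    conv_lhs => rw [eq_X_add_C_of_degree_le_one hrdeg]
    rw [map_add, map_mul, aeval_C, aeval_X, aeval_C]
  -- `χ(c₁)` is a root of `X² + pX + q`, so `χ(c₁) ∈ {σ, −p − σ}`
  have hχc₁ : χ c₁ = σ ∨ χ c₁ = -(p : ℂ) - σ := by
    have h0 : (χ c₁) ^ 2 + p * χ c₁ + q = 0 := by
      have := congrArg χ hc₁
      rwa [map_add, map_add, map_mul, map_pow, hχQ, hχQ, map_zero] at this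
    have hprod : (χ c₁ - σ) * (χ c₁ + p + σ) = 0 := by linear_combination h0 - hpq
    rcases mul_eq_zero.1 hprod with h | h
    · exact Or.inl (sub_eq_zero.1 h)
    · exact Or.inr (by linear_combination h)
  rw [mem_span_one_tau_iff]
  have hτ' : τ = b * χ c₁ + a := by rw [← h₂, hab, map_add, map_mul, hχQ, hχQ]
  rcases hχc₁ with h | h
  · exact ⟨a, b, by rw [hτ', h]; ring⟩
  · exact ⟨a - b * p, -b, by rw [hτ', h]; push_cast; ring⟩

end Subfield

/-! ## §2 Theorem (0.2) (2): the Hodge group of `X₀ × X₁ × X₂` in case (f) -/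

section CaseF

variable {κ : Type} [Fintype κ] [DecidableEq κ] [Nonempty κ] {E : Type} [NormedAddCommGroup E] [NormedSpace ℂ E]
  [FiniteDimensional ℂ E] {Ψ : (κ → ℝ) ≃L[ℝ] E} {η : E [⋀^Fin 2]→L[ℝ] ℝ} {σ τ : ℂ} (hσ : σ.im ≠ 0) (hτ : τ.im ≠ 0)

/-- **MOONEN–ZARHIN THM. (0.2) (2), CASE (f), THE HODGE GROUP: `Hg(X₀ × X₁ × X₂) = Hg(X₀) × Hg(X₁ × X₂)`** — on the
tree's carriers `X₂ = T` a SIMPLE polarised threefold, `X₁ = E_σ` an elliptic curve WITH complex multiplication whose CM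
field `ℚ(σ)` embeds into the centre `F = Z(End⁰ T)` (a complex embedding of `F` takes the value `σ`: case (a)), and
`X₀ = E_τ` ANY elliptic curve not isogenous to `E_σ`: `Hg((T × E_σ) × E_τ)(ℂ) = Hg(T × E_σ)(ℂ) × Hg(E_τ)(ℂ)`.  `E_τ` without
complex multiplication: (3.8) with `End(E_τ) = ℤ`, `Hom(E_τ, T × E_σ) = 0`; `E_τ` with: a non-split Hodge group embeds `ℚ(τ)`
into `F` too, and «this subfield is unique» (§1, `[F : ℚ] ∣ 6`) puts `τ ∈ ℚ + ℚσ`, i.e. `E_σ ∼ E_τ` — excluded.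
[cite: MoonenZarhin1999LowDim, Thm. (0.2) (2) (p0001 L157–L158), §5 (5.11) (p0010 L57–L63), (5.12) (p0011 L14–L16), §3 Prop. (3.8)]
[cite: Lange2023AbelianVarietiesComplex, §1.1.2 Cor. 1.1.16 and §2.4.4 Cor. 2.4.26] -/
theorem IsSimple.hodgeGroupC_prod_ellipticPeriod_prod_ellipticPeriod_eq_blockDiagProd_of_finrank_eq_three_of_apply_eq
    (hT : IsSimple Ψ) (hη : IsRiemannForm Ψ η) (h3 : finrank ℂ E = 3) (hCM : ellipticEnd hσ ≠ ⊥)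
    {φ : centerField Ψ hT →+* ℂ} {c : centerField Ψ hT} (hφc : φ c = σ)
    (hni : ¬ IsIsogenous (ellipticPeriod hσ) (ellipticPeriod hτ)) :
    hodgeGroupC (prodPeriod (prodPeriod Ψ (ellipticPeriod hσ)) (ellipticPeriod hτ)) =
      blockDiagProd (hodgeGroupC (prodPeriod Ψ (ellipticPeriod hσ))) (hodgeGroupC (ellipticPeriod hτ)) := by
  have hcard : Fintype.card κ ≠ Fintype.card (Fin 2) := by
    rw [card_eq_two_mul_finrank Ψ, h3, Fintype.card_fin]; norm_num
  have hAT : IsAbelianVariety Ψ := ⟨η, hη⟩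
  -- `Hom(E_τ, T) = 0`, `Hom(T, E_τ) = 0`, `Hom(E_τ, E_σ) = 0`
  have hτT : homRat (ellipticPeriod hτ) Ψ = ⊥ :=
    (isSimple_ellipticPeriod hτ).homRat_eq_bot_of_card_ne hT fun h' ↦ hcard h'.symm
  have hTτ : homRat Ψ (ellipticPeriod hτ) = ⊥ := hT.homRat_eq_bot_of_card_ne (isSimple_ellipticPeriod hτ) hcard
  have hτσ : homRat (ellipticPeriod hτ) (ellipticPeriod hσ) = ⊥ :=
    homRat_ellipticPeriod_eq_bot_of_not_isIsogenous hτ hσ fun h ↦ hni (h.symm _ _)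
  by_cases hEτ : ellipticEnd hτ = ⊥
  · -- `E_τ` without complex multiplication: Prop. (3.8) with `End(E_τ) = ℤ`
    exact (hAT.prod (isAbelianVariety_ellipticPeriod hσ)).hodgeGroupC_prod_ellipticPeriod_eq_blockDiagProd_of_homRat_eq_bot
      hτ hEτ ((homRat_prod_right_eq_bot_iff _ _ _).2 ⟨hτT, hτσ⟩)
  · -- `E_τ` with complex multiplication by `ℚ(τ)`
    by_contra hne
    rcases IsAbelianVariety.exists_algHom_center_endAlgRat_or_isIsogenous_of_hodgeGroupC_prod_ellipticPeriod_prod_ellipticPeriod_ne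
        hτ hσ hAT (hT.homRat_eq_bot_of_card_ne (isSimple_ellipticPeriod hσ) hcard)
        ((isSimple_ellipticPeriod hσ).homRat_eq_bot_of_card_ne hT fun h' ↦ hcard h'.symm) hEτ hne with ⟨χ, hτχ⟩ | h'
    · obtain ⟨c₂, hc₂⟩ := (AlgHom.mem_range χ).1 hτχ
      have hd : ¬ 4 ∣ finrank ℚ (centerField Ψ hT) := fun h4 ↦ by
        have h6 : finrank ℚ (centerField Ψ hT) ∣ 6 := by
          have := hT.finrank_centerField_dvd_two_mul (E := E)
          rwa [h3] at this
        have : (4 : ℕ) ∣ 6 := h4.trans h6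
        omega
      have hmem := mem_span_one_tau_of_ringHom_apply_eq hd hσ ((ellipticEnd_ne_bot_iff hσ).1 hCM)
        ((ellipticEnd_ne_bot_iff hτ).1 hEτ) φ χ.toRingHom hφc hc₂
      exact hni (isIsogenous_ellipticPeriod_of_mem_span_one_tau hσ hτ hmem)
    · exact hni h'

/-- The same on REAL POINTS: `Hg((T × E_σ) × E_τ)(ℝ) = Hg(T × E_σ)(ℝ) × Hg(E_τ)(ℝ)`.
[cite: MoonenZarhin1999LowDim, Thm. (0.2) (2) (p0001 L157–L158), §5 (5.11), §3 (3.1)] -/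
theorem IsSimple.hodgeGroup_prod_ellipticPeriod_prod_ellipticPeriod_eq_of_finrank_eq_three_of_apply_eq
    (hT : IsSimple Ψ) (hη : IsRiemannForm Ψ η) (h3 : finrank ℂ E = 3) (hCM : ellipticEnd hσ ≠ ⊥)
    {φ : centerField Ψ hT →+* ℂ} {c : centerField Ψ hT} (hφc : φ c = σ)
    (hni : ¬ IsIsogenous (ellipticPeriod hσ) (ellipticPeriod hτ)) :
    hodgeGroup (prodPeriod (prodPeriod Ψ (ellipticPeriod hσ)) (ellipticPeriod hτ)) =
      ((hodgeGroup (prodPeriod Ψ (ellipticPeriod hσ))).prod (hodgeGroup (ellipticPeriod hτ))).map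
        (blockDiag (κ ⊕ Fin 2) (Fin 2)) :=
  hodgeGroup_prod_eq_of_hodgeGroupC_prod_eq
    (hT.hodgeGroupC_prod_ellipticPeriod_prod_ellipticPeriod_eq_blockDiagProd_of_finrank_eq_three_of_apply_eq hσ hτ hη h3
      hCM hφc hni)

/-- **Case (f) read with an abstract embedding `k ↪ F`**: if the CM field of `E_σ` — any subfield `k ⊆ ℂ` containing `σ`,
given as a ring homomorphism `j : k → F = Z(End⁰ T)` compatible with SOME complex embedding `φ` of `F` (`φ (j x) = x`) —
embeds into the centre of `End⁰(T)`, and `E_τ ≁ E_σ`, then `Hg((T × E_σ) × E_τ)(ℂ) = Hg(T × E_σ)(ℂ) × Hg(E_τ)(ℂ)`.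
[cite: MoonenZarhin1999LowDim, Thm. (0.2) (2) (p0001 L157–L158), cases (a), (f) (p0001 L129–L135)] -/
theorem IsSimple.hodgeGroupC_prod_ellipticPeriod_prod_ellipticPeriod_eq_blockDiagProd_of_finrank_eq_three_of_subfield
    (hT : IsSimple Ψ) (hη : IsRiemannForm Ψ η) (h3 : finrank ℂ E = 3) (hCM : ellipticEnd hσ ≠ ⊥)
    {k : Subfield ℂ} (hσk : σ ∈ k) (j : k →+* centerField Ψ hT) (φ : centerField Ψ hT →+* ℂ)
    (hφj : ∀ x : k, φ (j x) = x) (hni : ¬ IsIsogenous (ellipticPeriod hσ) (ellipticPeriod hτ)) :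
    hodgeGroupC (prodPeriod (prodPeriod Ψ (ellipticPeriod hσ)) (ellipticPeriod hτ)) =
      blockDiagProd (hodgeGroupC (prodPeriod Ψ (ellipticPeriod hσ))) (hodgeGroupC (ellipticPeriod hτ)) :=
  hT.hodgeGroupC_prod_ellipticPeriod_prod_ellipticPeriod_eq_blockDiagProd_of_finrank_eq_three_of_apply_eq hσ hτ hη h3 hCM
    (hφj ⟨σ, hσk⟩) hni

/-- **The `IsAbelianVariety` form** (some polarisation of `T`). [cite: MoonenZarhin1999LowDim, Thm. (0.2) (2) (p0001 L157–L158), §5 (5.11)] -/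
theorem IsSimple.hodgeGroupC_prod_ellipticPeriod_prod_ellipticPeriod_eq_blockDiagProd_of_isAbelianVariety_of_finrank_eq_three_of_apply_eq
    (hT : IsSimple Ψ) (hA : IsAbelianVariety Ψ) (h3 : finrank ℂ E = 3) (hCM : ellipticEnd hσ ≠ ⊥)
    {φ : centerField Ψ hT →+* ℂ} {c : centerField Ψ hT} (hφc : φ c = σ)
    (hni : ¬ IsIsogenous (ellipticPeriod hσ) (ellipticPeriod hτ)) :
    hodgeGroupC (prodPeriod (prodPeriod Ψ (ellipticPeriod hσ)) (ellipticPeriod hτ)) =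
      blockDiagProd (hodgeGroupC (prodPeriod Ψ (ellipticPeriod hσ))) (hodgeGroupC (ellipticPeriod hτ)) := by
  obtain ⟨η, hη⟩ := hA
  exact hT.hodgeGroupC_prod_ellipticPeriod_prod_ellipticPeriod_eq_blockDiagProd_of_finrank_eq_three_of_apply_eq hσ hτ hη h3
    hCM hφc hni

end CaseF

end ComplexTorus

end Literature.Geometry.Kaehler
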